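import Literature.NumberTheory.Automorphic.UnitaryGroupArchLieLift
import Literature.NumberTheory.Automorphic.UnitaryRepKCasimirBlockBound
import Literature.NumberTheory.Automorphic.ArchTestFunctionSpace
import Literature.NumberTheory.Automorphic.UnitaryGroupArchTopology
import Literature.NumberTheory.Rogawski1990.GlobalAPacketMembership
import Literature.NumberTheory.Automorphic.UnitaryGroupArchUnimodular
import Literature.NumberTheory.Automorphic.GLnAdelicIntegrationFactsProofs
import HarnessLib

/-!
# Integration by parts for the archimedean integrated operator: `ϖ(φ) dϖ(X) v = −ϖ(R_X̃ φ) v`, and the `(1 + Ω_K)`-family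

Topic `NumberTheory/Automorphic`; namespace `Literature.NumberTheory.Automorphic.UnitaryGroup`. Theorems with proofs and two definitions
with bodies (`archRestrict`, `archKCasimirTest`); no named fact, no `sorry`.

Setting of ★ `ArchIntegratedOperatorTraceClass` (Knapp Thm. 10.2 for `G′_∞`): a CM field `L`, `ι`, `H`, a frame `T` (`Tᴴ ι(H) T = J`), the projection
★ `archProjUForm L ι H T hT : G′_∞ = U(H)(L⁺ ⊗ ℝ) →* U(2,1)`, a Haar measure `ν` on `G′_∞`, a unitary strongly continuous representation `ϖ` of
`U(2,1) = uFormGroup (Fin 2) (Fin 1)` on a Hilbert space `E`, pulled back along the projection, and an archimedean TEST FUNCTION `φ'` on `GL₃(L ⊗ ℝ)`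
(★ `IsArchTestFunction 3 L φ'`: continuous, compactly supported, ★ `IsArchSmooth` for the full linear group) restricted to `G′_∞`.

* §1 `archRestrict` (restriction to the closed subgroup `G′_∞` as an element of `C_c(G′_∞, ℂ)`), right invariance of `ν` (`G′_∞` is unimodular, ★
  `modularCharacterFun_arch_eq_one`), and the translation formula `integral_translate_archLieLift`:
  `∫ φ(g) ϖ(p(g) exp(sX)) v dν = ∫ φ'(g exp(−sX̃)) ϖ(p g) v dν` along the lifted one-parameter subgroup `exp(sX̃)` of ★ `UnitaryGroupArchLieLift`.
* §2 **`integratedOperator_archProjUForm_apply_dπ`**: for `v` a smooth vector and `X ∈ 𝔲(2,1)`,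
  `ϖ(φ) (dϖ(X) v) = −ϖ(R_X̃ φ') v` with `R_X̃ = archRightDeriv (archLieLift X)` (both sides are the derivative at `s = 0` of §1's two integrals:
  dominated differentiation under the integral sign, ★ `hasDerivAt_dπ` ∕ `ExpOrbit.hasDerivAt_orbit_smul` on the left, ★
  `IsArchTestFunction.hasDerivAt_right` on the right).
* §3 **`archKCasimirTest φ' = φ' − Σ_a R_{w̃_a} R_{w̃_a} φ'`** (`w̃_a = archLieLift (upqKVec a)`), a test function again, with
  **`integratedOperator_archProjUForm_apply_add_upqKCasimirVec`**: `ϖ(φ') (v + Ω_K v) = ϖ(archKCasimirTest φ') v` on `H_K^∞` (★ `upqKCasimirVec`), and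
  the resulting BLOCK ESTIMATE **`norm_integratedOperator_archProjUForm_apply_le_of_kBlock`**: on every `K`-irreducible finite-dimensional `K`-stable
  `W ≤ H^∞`, `‖ϖ(φ) v‖ ≤ ((1 + q_W)^n)⁻¹ ‖ϖ(archKCasimirTest^[n] φ')‖ ‖v‖` (★ `norm_apply_le_of_kBlock`) — the block constant of Harish-Chandra's proof
  that `ϖ(φ)` is of trace class, here for the archimedean operator of the cell.

Citations: V. S. Varadarajan, *An introduction to harmonic analysis on semisimple Lie groups* (1989), §5.4, proof of Thm. 22
(`f_{jk}(E^r; x; E^r) = c_η(E)^r c_ξ(E)^r f_{jk}(x)`, `E = 1 + ω_K`); A. W. Knapp, *Representation theory of semisimple groups* (1986), Thm. 10.2 and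
(10.4)–(10.6); A. Borel, H. Jacquet, Corvallis 1979, §4.1 (the archimedean factor).
-/

noncomputable section

open NumberField NumberField.InfinitePlace NumberField.mixedEmbedding NormedSpace MeasureTheory Measure Set Filter Topology CompactlySupported
open scoped Matrix MatrixGroups ComplexConjugate Classical InnerProductSpace

namespace Literature.NumberTheory.Automorphic.UnitaryGroup

open Literature.RepresentationTheory.KonnoKonno2007 Literature.RepresentationTheory.KonnoKonno2007.RealDualPair
open Literature.Geometry.ComplexHyperbolic Literature.Geometry.ComplexHyperbolic.BallModel
open Literature.RepresentationTheory.BorelWallach2000 (upqKVec upqKDim)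
open Literature.NumberTheory.Rogawski1990 (transpose_map_cmConjRingHom_eq_of_frame isUnit_det_of_frame)

variable (L : Type) [Field L] [NumberField L] [IsCMField L] (ι : L →+* ℂ) (H : Matrix (Fin 3) (Fin 3) L) (T : GL (Fin 3) ℂ)
  (hT : (T : Matrix (Fin 3) (Fin 3) ℂ)ᴴ * H.map ι * (T : Matrix (Fin 3) (Fin 3) ℂ) = J)

/-! ## §1 Restriction of test functions to `G′_∞` and the translation formula -/

/-- The restriction to the closed subgroup `G′_∞ = U(H)(L⁺ ⊗ ℝ) ≤ GL₃(L ⊗ ℝ)` of a continuous compactly supported function, as an element of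
`C_c(G′_∞, ℂ)`. [cite: BorelJacquet1979, §4.1] -/
def archRestrict (ψ : GL (Fin 3) (mixedSpace L) → ℂ) (hψc : Continuous ψ) (hψs : HasCompactSupport ψ) :
    C_c(arch (↥(maximalRealSubfield L)) L (IsCMField.complexConj L) 3 H, ℂ) :=
  ⟨⟨fun g => ψ (g : GL (Fin 3) (mixedSpace L)), hψc.comp continuous_subtype_val⟩,
    hψs.comp_isClosedEmbedding (isClosed_arch (↥(maximalRealSubfield L)) L (IsCMField.complexConj L) 3 H).isClosedEmbedding_subtypeVal⟩

/-- `archRestrict ψ g = ψ g`. [cite: BorelJacquet1979, §4.1] -/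
@[simp] theorem archRestrict_apply (ψ : GL (Fin 3) (mixedSpace L) → ℂ) (hψc : Continuous ψ) (hψs : HasCompactSupport ψ)
    (g : arch (↥(maximalRealSubfield L)) L (IsCMField.complexConj L) 3 H) :
    archRestrict L H ψ hψc hψs g = ψ (g : GL (Fin 3) (mixedSpace L)) := rfl

set_option backward.isDefEq.respectTransparency false in
open scoped Matrix.Norms.Operator in
omit [IsCMField L] in
/-- The exponential `M₃(L ⊗ ℝ) → GL₃(L ⊗ ℝ)` is continuous (a local copy of the tree's `continuous_expGL`). [cite: BorelJacquet1979, §4.1] -/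
theorem continuous_expGL_mixed : Continuous (expGL : Matrix (Fin 3) (Fin 3) (mixedSpace L) → GL (Fin 3) (mixedSpace L)) := by
  refine Units.continuous_iff.2 ⟨?_, ?_⟩
  · exact NormedSpace.exp_continuous
  · have h : (fun X : Matrix (Fin 3) (Fin 3) (mixedSpace L) => (↑(expGL X)⁻¹ : Matrix (Fin 3) (Fin 3) (mixedSpace L))) =
        fun X => NormedSpace.exp (-X) := by
      funext X
      rw [← expGL_neg]
      rfl
    change Continuous fun X : Matrix (Fin 3) (Fin 3) (mixedSpace L) => (↑(expGL X)⁻¹ : Matrix (Fin 3) (Fin 3) (mixedSpace L))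
    rw [h]
    exact NormedSpace.exp_continuous.comp continuous_neg

variable [MeasurableSpace (arch (↥(maximalRealSubfield L)) L (IsCMField.complexConj L) 3 H)]
  [BorelSpace (arch (↥(maximalRealSubfield L)) L (IsCMField.complexConj L) 3 H)]

include hT in
/-- **A Haar measure on `G′_∞` is right invariant** (the group is unimodular, ★ `modularCharacterFun_arch_eq_one`, `H` being hermitian and non-degenerate by the
frame). [cite: Rogawski1990, §14.2 p. 232] -/
theorem isMulRightInvariant_arch_of_frame (ν : Measure (arch (↥(maximalRealSubfield L)) L (IsCMField.complexConj L) 3 H)) [ν.IsHaarMeasure] :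
    ν.IsMulRightInvariant :=
  isMulRightInvariant_of_modularCharacterFun_eq_one
    (fun g => modularCharacterFun_arch_eq_one L H (transpose_map_cmConjRingHom_eq_of_frame L ι H T hT)
      (isUnit_det_of_frame L ι H T hT).ne_zero g) ν

variable {E : Type*} [NormedAddCommGroup E] [InnerProductSpace ℂ E] [CompleteSpace E]
  (ϖ : ContRepresentation ℂ (uFormGroup (Fin 2) (Fin 1)).carrier E)

/-- `exp 0 = 1` in `U(2,1)`. [cite: BorelWallach2000, Ch. 0 §2.5] -/
theorem expMem_zero_uForm : (uFormGroup (Fin 2) (Fin 1)).expMem 0 = 1 := by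
  refine Subtype.ext (Units.ext ?_)
  simp only [RealMatrixGroup.coe_expMem, coe_expGL, ZeroMemClass.coe_zero, NormedSpace.exp_zero, Subgroup.coe_one, Units.val_one]

omit [CompleteSpace E] in
include hT in
/-- **The translation formula along the lifted one-parameter subgroup**: for every `s`,
`∫ φ(g) • ϖ(p g) (ϖ(exp (sX)) w) dν = ∫ φ'(g · exp(−s X̃)) • ϖ(p g) w dν` (`p = archProjUForm`, `X̃ = archLieLift X`; right invariance of `ν` and ★
`archProjUForm_expGL_archLieLift`). [cite: Varadarajan1989, §5.4 (proof of Thm. 22)] -/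
theorem integral_translate_archLieLift (ν : Measure (arch (↥(maximalRealSubfield L)) L (IsCMField.complexConj L) 3 H)) [ν.IsHaarMeasure]
    {φ' : GL (Fin 3) (mixedSpace L) → ℂ} (φ : arch (↥(maximalRealSubfield L)) L (IsCMField.complexConj L) 3 H → ℂ)
    (hφ : ∀ k, φ k = φ' (k : GL (Fin 3) (mixedSpace L))) (X : (uFormGroup (Fin 2) (Fin 1)).lie) (w : E) (s : ℝ) :
    ∫ g, φ g • ϖ (archProjUForm L ι H T hT g) (ϖ ((uFormGroup (Fin 2) (Fin 1)).expMem (s • X)) w) ∂ν =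
      ∫ g, φ' ((g : GL (Fin 3) (mixedSpace L)) * expGL ((-s) • archLieLift L ι T (X : Matrix (Fin 2 ⊕ Fin 1) (Fin 2 ⊕ Fin 1) ℂ))) •
        ϖ (archProjUForm L ι H T hT g) w ∂ν := by
  haveI := isMulRightInvariant_arch_of_frame L ι H T hT ν
  set γ : arch (↥(maximalRealSubfield L)) L (IsCMField.complexConj L) 3 H :=
    ⟨expGL (s • archLieLift L ι T (X : Matrix (Fin 2 ⊕ Fin 1) (Fin 2 ⊕ Fin 1) ℂ)), expGL_archLieLift_mem L ι H T hT X s⟩ with hγ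
  have hγp : archProjUForm L ι H T hT γ = (uFormGroup (Fin 2) (Fin 1)).expMem (s • X) := archProjUForm_expGL_archLieLift L ι H T hT X s
  have hγinv : ((γ⁻¹ : arch (↥(maximalRealSubfield L)) L (IsCMField.complexConj L) 3 H) : GL (Fin 3) (mixedSpace L)) =
      expGL ((-s) • archLieLift L ι T (X : Matrix (Fin 2 ⊕ Fin 1) (Fin 2 ⊕ Fin 1) ℂ)) := by
    rw [Subgroup.coe_inv, hγ, neg_smul, expGL_neg]
  -- `∫ F(g γ) = ∫ F` for `F h := φ(h γ⁻¹) • ϖ(p h) w`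
  calc ∫ g, φ g • ϖ (archProjUForm L ι H T hT g) (ϖ ((uFormGroup (Fin 2) (Fin 1)).expMem (s • X)) w) ∂ν
      = ∫ g, (fun h : arch (↥(maximalRealSubfield L)) L (IsCMField.complexConj L) 3 H =>
          φ (h * γ⁻¹) • ϖ (archProjUForm L ι H T hT h) w) (g * γ) ∂ν := by
        refine integral_congr_ae (Eventually.of_forall fun g => ?_)
        simp only [mul_inv_cancel_right, map_mul, hγp]
        rfl
    _ = ∫ g, φ (g * γ⁻¹) • ϖ (archProjUForm L ι H T hT g) w ∂ν :=
        integral_mul_right_eq_self (μ := ν)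
          (fun h : arch (↥(maximalRealSubfield L)) L (IsCMField.complexConj L) 3 H => φ (h * γ⁻¹) • ϖ (archProjUForm L ι H T hT h) w) γ
    _ = _ := by
        refine integral_congr_ae (Eventually.of_forall fun g => ?_)
        simp only [hφ, Subgroup.coe_mul, hγinv]

/-! ## §2 Integration by parts: `ϖ(φ) dϖ(X) v = −ϖ(R_X̃ φ) v` -/

include hT in
/-- **`ϖ(φ) (dϖ(X) v) = −ϖ(R_X̃ φ') v`** for the archimedean integrated operator `ϖ(φ) = ∫_{G′_∞} φ(g) ϖ(p g) dν(g)` of ★ `ArchIntegratedOperatorTraceClass`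
(`p = archProjUForm`), a smooth vector `v` of `ϖ`, `X ∈ 𝔲(2,1)`, an archimedean test function `φ'` on `GL₃(L ⊗ ℝ)` with restriction `φ`, and the right
derivative `R_X̃ φ' = archRightDeriv (archLieLift X) φ'` along the lift of `X`: both sides are the derivative at `s = 0` of the two sides of
`integral_translate_archLieLift` (dominated differentiation under the integral). [cite: Varadarajan1989, §5.4 (proof of Thm. 22)] [cite: Knapp1986, Thm. 10.2 (10.4)–(10.6)] -/
theorem integratedOperator_archProjUForm_apply_dπ (ν : Measure (arch (↥(maximalRealSubfield L)) L (IsCMField.complexConj L) 3 H)) [ν.IsHaarMeasure]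
    (hu : ϖ.IsUnitary) (hc : ϖ.IsStronglyContinuous) {φ' : GL (Fin 3) (mixedSpace L) → ℂ} (hφ' : IsArchTestFunction 3 L φ')
    (φ : arch (↥(maximalRealSubfield L)) L (IsCMField.complexConj L) 3 H → ℂ) (hφc : Continuous φ) (hφs : HasCompactSupport φ)
    (hφ : ∀ k, φ k = φ' (k : GL (Fin 3) (mixedSpace L))) (X : (uFormGroup (Fin 2) (Fin 1)).lie) {v : E}
    (hv : v ∈ smoothVectors (uFormGroup (Fin 2) (Fin 1)) ϖ) :
    (ϖ.restrict (archProjUForm L ι H T hT)).integratedOperator (hu.restrict _)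
        (hc.restrict _ (continuous_archProjUForm L ι H T hT)) ν ⟨⟨φ, hφc⟩, hφs⟩ (dπ (uFormGroup (Fin 2) (Fin 1)) ϖ v X) =
      -(ϖ.restrict (archProjUForm L ι H T hT)).integratedOperator (hu.restrict _)
        (hc.restrict _ (continuous_archProjUForm L ι H T hT)) ν
        (archRestrict L H (archRightDeriv (archLieLift L ι T (X : Matrix (Fin 2 ⊕ Fin 1) (Fin 2 ⊕ Fin 1) ℂ)) φ')
          (hφ'.archRightDeriv _).continuous (hφ'.archRightDeriv _).hasCompactSupport) v := by
  -- notation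
  set p := archProjUForm L ι H T hT with hp
  set Xt := archLieLift L ι T (X : Matrix (Fin 2 ⊕ Fin 1) (Fin 2 ⊕ Fin 1) ℂ) with hXt
  set R := archRightDeriv Xt φ' with hR
  have hRt : IsArchTestFunction 3 L R := hφ'.archRightDeriv Xt
  have hpc : Continuous p := continuous_archProjUForm L ι H T hT
  have hϖc : ∀ w : E, Continuous fun g : arch (↥(maximalRealSubfield L)) L (IsCMField.complexConj L) 3 H => ϖ (p g) w :=
    fun w => by simpa only [Function.comp_def] using (hc w).comp hpc
  -- (a) the left-hand side: `s ↦ ∫ φ g • ϖ(p g) (ϖ(exp sX) v)` has derivative `∫ φ g • ϖ(p g) (dϖ(X) v)` at `0`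
  have hcurve : ∀ s : ℝ, HasDerivAt (fun t : ℝ => ϖ ((uFormGroup (Fin 2) (Fin 1)).expMem (t • X)) v)
      (ϖ ((uFormGroup (Fin 2) (Fin 1)).expMem (s • X)) (dπ (uFormGroup (Fin 2) (Fin 1)) ϖ v X)) s := fun s =>
    ExpOrbit.hasDerivAt_orbit_smul (uFormGroup (Fin 2) (Fin 1)) (realRep (uFormGroup (Fin 2) (Fin 1)) ϖ)
      (differentiableAt_of_mem_smoothVectors (uFormGroup (Fin 2) (Fin 1)) ϖ hv).hasFDerivAt ⟨X, X.2⟩ s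
  have hA : HasDerivAt (fun s : ℝ => ∫ g, φ g • ϖ (p g) (ϖ ((uFormGroup (Fin 2) (Fin 1)).expMem (s • X)) v) ∂ν) (∫ g, φ g • ϖ (p g) (dπ (uFormGroup (Fin 2) (Fin 1)) ϖ v X) ∂ν) 0 := by
    have h := hasDerivAt_integral_of_dominated_loc_of_deriv_le (μ := ν) (x₀ := (0 : ℝ)) (s := univ)
      (F := fun s g => φ g • ϖ (p g) (ϖ ((uFormGroup (Fin 2) (Fin 1)).expMem (s • X)) v)) (F' := fun s g => φ g • ϖ (p g) (ϖ ((uFormGroup (Fin 2) (Fin 1)).expMem (s • X)) (dπ (uFormGroup (Fin 2) (Fin 1)) ϖ v X)))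
      (bound := fun g => ‖φ g‖ * ‖dπ (uFormGroup (Fin 2) (Fin 1)) ϖ v X‖) univ_mem
      (Eventually.of_forall fun s => (hφc.smul (hϖc _)).aestronglyMeasurable)
      ((hφc.smul (hϖc _)).integrable_of_hasCompactSupport hφs.smul_right)
      (hφc.smul (hϖc _)).aestronglyMeasurable
      (Eventually.of_forall fun g s _ => le_of_eq (by rw [_root_.norm_smul, hu.norm_map, hu.norm_map]))
      ((hφc.norm.mul continuous_const).integrable_of_hasCompactSupport hφs.norm.mul_right)
      (Eventually.of_forall fun g s _ => by
        have h1 : HasDerivAt (fun t : ℝ => ϖ (p g) (ϖ ((uFormGroup (Fin 2) (Fin 1)).expMem (t • X)) v))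
            (ϖ (p g) (ϖ ((uFormGroup (Fin 2) (Fin 1)).expMem (s • X)) (dπ (uFormGroup (Fin 2) (Fin 1)) ϖ v X))) s :=
          by
            have h0 := ((ϖ (p g)).restrictScalars ℝ).hasFDerivAt.comp_hasDerivAt s (hcurve s)
            simpa only [ContinuousLinearMap.coe_restrictScalars', Function.comp_def] using h0
        exact h1.const_smul (φ g))
    simpa only [zero_smul, expMem_zero_uForm, map_one, one_apply_eq_self] using h.2
  -- (b) the right-hand side: `s ↦ ∫ φ'(g exp(−sX̃)) • ϖ(p g) v` has derivative `−∫ R(g) • ϖ(p g) v` at `0`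
  obtain ⟨C, hC⟩ := hRt.hasCompactSupport.exists_bound_of_continuous hRt.continuous
  have hC0 : 0 ≤ C := (norm_nonneg _).trans (hC 1)
  have hmulc : ∀ c : GL (Fin 3) (mixedSpace L),
      Continuous fun g : arch (↥(maximalRealSubfield L)) L (IsCMField.complexConj L) 3 H => (g : GL (Fin 3) (mixedSpace L)) * c :=
    fun c => continuous_subtype_val.mul continuous_const
  have hFmeas : ∀ s : ℝ, AEStronglyMeasurable (fun g : arch (↥(maximalRealSubfield L)) L (IsCMField.complexConj L) 3 H =>
      φ' ((g : GL (Fin 3) (mixedSpace L)) * expGL ((-s) • Xt)) • ϖ (p g) v) ν :=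
    fun s => ((hφ'.continuous.comp (hmulc _)).smul (hϖc v)).aestronglyMeasurable
  have hF'meas : ∀ s : ℝ, AEStronglyMeasurable (fun g : arch (↥(maximalRealSubfield L)) L (IsCMField.complexConj L) 3 H =>
      -(R ((g : GL (Fin 3) (mixedSpace L)) * expGL ((-s) • Xt))) • ϖ (p g) v) ν :=
    fun s => (((hRt.continuous.comp (hmulc _)).neg).smul (hϖc v)).aestronglyMeasurable
  set γ : ℝ → arch (↥(maximalRealSubfield L)) L (IsCMField.complexConj L) 3 H :=
    fun s => ⟨expGL (s • Xt), expGL_archLieLift_mem L ι H T hT X s⟩ with hγ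
  have hγc : Continuous γ := ((continuous_expGL_mixed L).comp (continuous_id.smul continuous_const)).subtype_mk _
  -- the compact set carrying the supports of `g ↦ R (g exp(−sX̃))`, `|s| ≤ 1`
  set ψR := archRestrict L H R hRt.continuous hRt.hasCompactSupport with hψR
  set S : Set (arch (↥(maximalRealSubfield L)) L (IsCMField.complexConj L) 3 H) :=
    (fun q : (arch (↥(maximalRealSubfield L)) L (IsCMField.complexConj L) 3 H) × ℝ => q.1 * γ q.2) ''
      (tsupport ψR ×ˢ Metric.closedBall (0 : ℝ) 1) with hS
  have hSc : IsCompact S :=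
    (ψR.hasCompactSupport.prod (isCompact_closedBall (0 : ℝ) 1)).image (continuous_fst.mul (hγc.comp continuous_snd))
  have hvanish : ∀ g ∉ S, ∀ s ∈ Metric.ball (0 : ℝ) 1, R ((g : GL (Fin 3) (mixedSpace L)) * expGL ((-s) • Xt)) = 0 := by
    intro g hg s hs
    by_contra hne
    apply hg
    refine ⟨(g * γ (-s), s), ⟨subset_tsupport _ ?_, Metric.ball_subset_closedBall hs⟩, ?_⟩
    · rw [Function.mem_support]
      simpa only [hψR, archRestrict_apply, hγ, Subgroup.coe_mul] using hne
    · change g * γ (-s) * γ s = g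
      have h1 : γ (-s) * γ s = 1 := Subtype.ext (by
        simp only [hγ, Subgroup.coe_mul, Subgroup.coe_one, neg_smul, expGL_neg, inv_mul_cancel])
      rw [mul_assoc, h1, mul_one]
  have hB : HasDerivAt (fun s : ℝ => ∫ g, φ' ((g : GL (Fin 3) (mixedSpace L)) * expGL ((-s) • Xt)) • ϖ (p g) v ∂ν)
      (∫ g, -(R ((g : GL (Fin 3) (mixedSpace L)) * expGL ((-(0 : ℝ)) • Xt))) • ϖ (p g) v ∂ν) 0 := by
    have hF0 : (fun g : arch (↥(maximalRealSubfield L)) L (IsCMField.complexConj L) 3 H =>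
        φ' ((g : GL (Fin 3) (mixedSpace L)) * expGL ((-(0 : ℝ)) • Xt)) • ϖ (p g) v) = fun g => φ g • ϖ (p g) v := by
      funext g
      rw [neg_zero, zero_smul, expGL_zero, mul_one, hφ]
    have h := hasDerivAt_integral_of_dominated_loc_of_deriv_le (μ := ν) (x₀ := (0 : ℝ)) (s := Metric.ball (0 : ℝ) 1)
      (F := fun s g => φ' ((g : GL (Fin 3) (mixedSpace L)) * expGL ((-s) • Xt)) • ϖ (p g) v)
      (F' := fun s g => -(R ((g : GL (Fin 3) (mixedSpace L)) * expGL ((-s) • Xt))) • ϖ (p g) v)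
      (bound := S.indicator fun _ => C * ‖v‖) (Metric.ball_mem_nhds 0 one_pos)
      (Eventually.of_forall fun s => hFmeas s)
      (by rw [hF0]; exact (hφc.smul (hϖc v)).integrable_of_hasCompactSupport hφs.smul_right)
      (hF'meas 0)
      (Eventually.of_forall fun g s hs => by
        by_cases hg : g ∈ S
        · rw [indicator_of_mem hg, _root_.norm_smul, norm_neg, hu.norm_map]
          exact mul_le_mul_of_nonneg_right (hC _) (norm_nonneg _)
        · rw [hvanish g hg s hs, neg_zero, zero_smul, norm_zero]
          exact indicator_nonneg (fun _ _ => mul_nonneg hC0 (norm_nonneg v)) _)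
      ((continuousOn_const.integrableOn_compact hSc).integrable_indicator hSc.measurableSet)
      (Eventually.of_forall fun g s _ => by
        have h1 := (hφ'.hasDerivAt_right Xt (g : GL (Fin 3) (mixedSpace L)) (-s)).scomp s (hasDerivAt_neg s)
        have h2 := h1.smul_const (ϖ (p g) v)
        simpa only [neg_one_smul, Function.comp_def] using h2)
    exact h.2
  -- the two parametrised integrals agree (§1), hence so do their derivatives at `0`
  have hAB : (fun s : ℝ => ∫ g, φ g • ϖ (p g) (ϖ ((uFormGroup (Fin 2) (Fin 1)).expMem (s • X)) v) ∂ν) =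
      fun s : ℝ => ∫ g, φ' ((g : GL (Fin 3) (mixedSpace L)) * expGL ((-s) • Xt)) • ϖ (p g) v ∂ν :=
    funext fun s => integral_translate_archLieLift L ι H T hT ϖ ν φ hφ X v s
  rw [hAB] at hA
  have heq := hA.unique hB
  simp only [neg_zero, zero_smul, expGL_zero, mul_one] at heq
  rw [ContRepresentation.integratedOperator_apply, ContRepresentation.integratedOperator_apply]
  change ∫ g, φ g • ϖ (p g) (dπ (uFormGroup (Fin 2) (Fin 1)) ϖ v X) ∂ν = -∫ g, R (g : GL (Fin 3) (mixedSpace L)) • ϖ (p g) v ∂ν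
  rw [heq]
  simp only [neg_smul, integral_neg]

/-! ## §3 The `(1 + Ω_K)`-family and the block estimate -/

/-- **`archKCasimirTest φ' = φ' − Σ_a R_{w̃_a} (R_{w̃_a} φ')`**, `w̃_a = archLieLift (w_a)` for the pseudo-orthonormal basis `(w_a)` of `𝔨 ⊆ 𝔲(2,1)` (★
`upqKVec`): the test function whose integrated operator is `ϖ(φ') (1 + Ω_K)` on `H_K^∞`. [cite: Varadarajan1989, §5.4 (proof of Thm. 22: `E = 1 + ω_K`)] -/
def archKCasimirTest (ψ : GL (Fin 3) (mixedSpace L) → ℂ) : GL (Fin 3) (mixedSpace L) → ℂ :=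
  ψ - ∑ a : Fin (upqKDim (Fin 2) (Fin 1)),
    archRightDeriv (archLieLift L ι T (upqKVec (Fin 2) (Fin 1) a : Matrix (Fin 2 ⊕ Fin 1) (Fin 2 ⊕ Fin 1) ℂ))
      (archRightDeriv (archLieLift L ι T (upqKVec (Fin 2) (Fin 1) a : Matrix (Fin 2 ⊕ Fin 1) (Fin 2 ⊕ Fin 1) ℂ)) ψ)

/-- `archKCasimirTest` preserves archimedean test functions (★ `IsArchTestFunction.archRightDeriv`, ★ `archTestFunctions`). [cite: Varadarajan1989, §5.4] -/
theorem isArchTestFunction_archKCasimirTest {ψ : GL (Fin 3) (mixedSpace L) → ℂ} (hψ : IsArchTestFunction 3 L ψ) :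
    IsArchTestFunction 3 L (archKCasimirTest L ι T ψ) := by
  have h : archKCasimirTest L ι T ψ ∈ archTestFunctions 3 L := by
    refine Submodule.sub_mem _ hψ (Submodule.sum_mem _ fun a _ => ?_)
    exact (hψ.archRightDeriv _).archRightDeriv _
  exact h

/-- Iterates of `archKCasimirTest` preserve archimedean test functions. [cite: Varadarajan1989, §5.4] -/
theorem isArchTestFunction_iterate_archKCasimirTest {ψ : GL (Fin 3) (mixedSpace L) → ℂ} (hψ : IsArchTestFunction 3 L ψ) (j : ℕ) :
    IsArchTestFunction 3 L ((archKCasimirTest L ι T)^[j] ψ) := by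
  induction j with
  | zero => exact hψ
  | succ j ih =>
    rw [Function.iterate_succ_apply']
    exact isArchTestFunction_archKCasimirTest L ι T ih

/-- The integrated operator is additive in the test function: `ϖ(ψ − Σ_i F_i) w = ϖ(ψ) w − Σ_i ϖ(F_i) w`. [cite: DeitmarEchterhoff2014, Prop. 6.2.1] -/
theorem integratedOperator_archRestrict_sub_sum (ν : Measure (arch (↥(maximalRealSubfield L)) L (IsCMField.complexConj L) 3 H))
    [ν.IsHaarMeasure] (hu : ϖ.IsUnitary) (hc : ϖ.IsStronglyContinuous) {ψ : GL (Fin 3) (mixedSpace L) → ℂ} (hψc : Continuous ψ)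
    (hψs : HasCompactSupport ψ) {ι' : Type*} (s : Finset ι') (F : ι' → GL (Fin 3) (mixedSpace L) → ℂ) (hFc : ∀ i, Continuous (F i))
    (hFs : ∀ i, HasCompactSupport (F i)) (hc' : Continuous (ψ - ∑ i ∈ s, F i)) (hs' : HasCompactSupport (ψ - ∑ i ∈ s, F i)) (w : E) :
    (ϖ.restrict (archProjUForm L ι H T hT)).integratedOperator (hu.restrict _) (hc.restrict _ (continuous_archProjUForm L ι H T hT)) ν
        (archRestrict L H (ψ - ∑ i ∈ s, F i) hc' hs') w =
      (ϖ.restrict (archProjUForm L ι H T hT)).integratedOperator (hu.restrict _) (hc.restrict _ (continuous_archProjUForm L ι H T hT)) ν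
          (archRestrict L H ψ hψc hψs) w -
        ∑ i ∈ s, (ϖ.restrict (archProjUForm L ι H T hT)).integratedOperator (hu.restrict _)
          (hc.restrict _ (continuous_archProjUForm L ι H T hT)) ν (archRestrict L H (F i) (hFc i) (hFs i)) w := by
  have hint : ∀ (f : C_c(arch (↥(maximalRealSubfield L)) L (IsCMField.complexConj L) 3 H, ℂ)),
      Integrable (fun g => f g • (ϖ.restrict (archProjUForm L ι H T hT)) g w) ν :=
    fun f => ContRepresentation.integrable_smul_apply (hc.restrict _ (continuous_archProjUForm L ι H T hT)) ν f w
  simp only [ContRepresentation.integratedOperator_apply]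
  rw [← integral_finsetSum s fun i _ => hint _, ← integral_sub (hint _) (integrable_finsetSum s fun i _ => hint _)]
  refine integral_congr_ae (Eventually.of_forall fun g => ?_)
  simp only [archRestrict_apply, Pi.sub_apply, Finset.sum_apply, sub_smul, Finset.sum_smul]

include hT in
/-- **`ϖ(ψ) (v + Ω_K v) = ϖ(archKCasimirTest ψ) v` on smooth vectors** — the hypothesis `hT` of ★ `norm_apply_le_of_kBlock` for the family
`T j = ϖ(archKCasimirTest^[j] φ')`: `ϖ(ψ) Ω_K v = −Σ_a ϖ(ψ) dϖ(w_a) dϖ(w_a) v = −Σ_a ϖ(R_{w̃_a} R_{w̃_a} ψ) v` by §2 twice. [cite: Varadarajan1989, §5.4 (proof of Thm. 22)]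
[cite: Knapp1986, Thm. 10.2 (10.4)–(10.6)] -/
theorem integratedOperator_archProjUForm_apply_add_upqKCasimirVec
    (ν : Measure (arch (↥(maximalRealSubfield L)) L (IsCMField.complexConj L) 3 H)) [ν.IsHaarMeasure] (hu : ϖ.IsUnitary)
    (hc : ϖ.IsStronglyContinuous) {ψ : GL (Fin 3) (mixedSpace L) → ℂ} (hψ : IsArchTestFunction 3 L ψ) {v : E}
    (hv : v ∈ smoothVectors (uFormGroup (Fin 2) (Fin 1)) ϖ) :
    (ϖ.restrict (archProjUForm L ι H T hT)).integratedOperator (hu.restrict _) (hc.restrict _ (continuous_archProjUForm L ι H T hT)) ν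
        (archRestrict L H ψ hψ.continuous hψ.hasCompactSupport) (v + upqKCasimirVec ϖ v) =
      (ϖ.restrict (archProjUForm L ι H T hT)).integratedOperator (hu.restrict _) (hc.restrict _ (continuous_archProjUForm L ι H T hT)) ν
        (archRestrict L H (archKCasimirTest L ι T ψ) (isArchTestFunction_archKCasimirTest L ι T hψ).continuous
          (isArchTestFunction_archKCasimirTest L ι T hψ).hasCompactSupport) v := by
  -- §2 for restrictions of test functions
  have key : ∀ {χ : GL (Fin 3) (mixedSpace L) → ℂ} (hχ : IsArchTestFunction 3 L χ) (Y : (uFormGroup (Fin 2) (Fin 1)).lie) {u : E}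
      (hu' : u ∈ smoothVectors (uFormGroup (Fin 2) (Fin 1)) ϖ),
      (ϖ.restrict (archProjUForm L ι H T hT)).integratedOperator (hu.restrict _) (hc.restrict _ (continuous_archProjUForm L ι H T hT)) ν
          (archRestrict L H χ hχ.continuous hχ.hasCompactSupport) (dπ (uFormGroup (Fin 2) (Fin 1)) ϖ u Y) =
        -(ϖ.restrict (archProjUForm L ι H T hT)).integratedOperator (hu.restrict _) (hc.restrict _ (continuous_archProjUForm L ι H T hT)) ν
          (archRestrict L H (archRightDeriv (archLieLift L ι T (Y : Matrix (Fin 2 ⊕ Fin 1) (Fin 2 ⊕ Fin 1) ℂ)) χ)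
            (hχ.archRightDeriv _).continuous (hχ.archRightDeriv _).hasCompactSupport) u :=
    fun {χ} hχ Y u hu' => integratedOperator_archProjUForm_apply_dπ L ι H T hT ϖ ν hu hc hχ (fun k => χ k) _ _ (fun _ => rfl) Y hu'
  rw [map_add, upqKCasimirVec, map_neg, _root_.map_sum]
  unfold archKCasimirTest
  rw [integratedOperator_archRestrict_sub_sum L ι H T hT ϖ ν hu hc hψ.continuous hψ.hasCompactSupport Finset.univ _
    (fun a => ((hψ.archRightDeriv _).archRightDeriv _).continuous) (fun a => ((hψ.archRightDeriv _).archRightDeriv _).hasCompactSupport)]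
  rw [sub_eq_add_neg, ← Finset.sum_neg_distrib]
  congr 1
  rw [← Finset.sum_neg_distrib]
  refine Finset.sum_congr rfl fun a _ => ?_
  rw [key hψ (upqKVec (Fin 2) (Fin 1) a) (dπ_mem_smoothVectors _ ϖ hc hv _), neg_neg,
    key (hψ.archRightDeriv _) (upqKVec (Fin 2) (Fin 1) a) hv]

include hT in
/-- **THE BLOCK ESTIMATE for the archimedean integrated operator**: on every finite-dimensional `K`-stable `K`-irreducible `W ≤ H^∞` (Schur scalar
`q_W ≥ 0` of `Ω_K`, ★ `upqKBlockScalar`), for every `n`, `‖ϖ(φ) v‖ ≤ ((1 + q_W)^n)⁻¹ · ‖ϖ(archKCasimirTest^[n] φ')‖ · ‖v‖` for `v ∈ W` — ★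
`norm_apply_le_of_kBlock` for `T j = ϖ(archKCasimirTest^[j] φ')`. [cite: Varadarajan1989, §5.4 Thm. 22 (proof)] [cite: Knapp1986, Thm. 10.2] -/
theorem norm_integratedOperator_archProjUForm_apply_le_of_kBlock
    (ν : Measure (arch (↥(maximalRealSubfield L)) L (IsCMField.complexConj L) 3 H)) [ν.IsHaarMeasure] (hu : ϖ.IsUnitary)
    (hc : ϖ.IsStronglyContinuous) {φ' : GL (Fin 3) (mixedSpace L) → ℂ} (hφ' : IsArchTestFunction 3 L φ')
    (φ : arch (↥(maximalRealSubfield L)) L (IsCMField.complexConj L) 3 H → ℂ) (hφc : Continuous φ) (hφs : HasCompactSupport φ)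
    (hφ : ∀ k, φ k = φ' (k : GL (Fin 3) (mixedSpace L))) (W : Submodule ℂ E) [FiniteDimensional ℂ W]
    (hWs : W ≤ smoothVectors (uFormGroup (Fin 2) (Fin 1)) ϖ)
    (hWK : ∀ (k : (uFormGroup (Fin 2) (Fin 1)).maximalCompact) (v : E), v ∈ W →
      ϖ (Subgroup.inclusion (uFormGroup (Fin 2) (Fin 1)).maximalCompact_le_carrier k) v ∈ W)
    (hWirr : ∀ W' : Submodule ℂ E, W' ≤ W →
      (∀ (k : (uFormGroup (Fin 2) (Fin 1)).maximalCompact) (v : E), v ∈ W' →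
        ϖ (Subgroup.inclusion (uFormGroup (Fin 2) (Fin 1)).maximalCompact_le_carrier k) v ∈ W') → W' = ⊥ ∨ W' = W)
    (n : ℕ) {v : E} (hv : v ∈ W) :
    ‖(ϖ.restrict (archProjUForm L ι H T hT)).integratedOperator (hu.restrict _) (hc.restrict _ (continuous_archProjUForm L ι H T hT)) ν
        ⟨⟨φ, hφc⟩, hφs⟩ v‖ ≤
      ((1 + upqKBlockScalar ϖ W) ^ n)⁻¹ *
        (‖(ϖ.restrict (archProjUForm L ι H T hT)).integratedOperator (hu.restrict _) (hc.restrict _ (continuous_archProjUForm L ι H T hT)) ν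
            (archRestrict L H ((archKCasimirTest L ι T)^[n] φ') (isArchTestFunction_iterate_archKCasimirTest L ι T hφ' n).continuous
              (isArchTestFunction_iterate_archKCasimirTest L ι T hφ' n).hasCompactSupport)‖ * ‖v‖) := by
  set Tj : ℕ → (E →L[ℂ] E) := fun j =>
    (ϖ.restrict (archProjUForm L ι H T hT)).integratedOperator (hu.restrict _) (hc.restrict _ (continuous_archProjUForm L ι H T hT)) ν
      (archRestrict L H ((archKCasimirTest L ι T)^[j] φ') (isArchTestFunction_iterate_archKCasimirTest L ι T hφ' j).continuous
        (isArchTestFunction_iterate_archKCasimirTest L ι T hφ' j).hasCompactSupport) with hTj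
  have hT0 : (⟨⟨φ, hφc⟩, hφs⟩ : C_c(arch (↥(maximalRealSubfield L)) L (IsCMField.complexConj L) 3 H, ℂ)) =
      archRestrict L H ((archKCasimirTest L ι T)^[0] φ') (isArchTestFunction_iterate_archKCasimirTest L ι T hφ' 0).continuous
        (isArchTestFunction_iterate_archKCasimirTest L ι T hφ' 0).hasCompactSupport := by
    ext k
    exact hφ k
  have hTrec : ∀ j < n, ∀ u ∈ harishChandraSpace (uFormGroup (Fin 2) (Fin 1)) ϖ, Tj j (u + upqKCasimirVec ϖ u) = Tj (j + 1) u := by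
    intro j _ u hu'
    simp only [hTj, Function.iterate_succ_apply']
    exact integratedOperator_archProjUForm_apply_add_upqKCasimirVec L ι H T hT ϖ ν hu hc
      (isArchTestFunction_iterate_archKCasimirTest L ι T hφ' j) hu'.1
  have h := norm_apply_le_of_kBlock ϖ W hu hc hWs hWK hWirr n Tj hTrec hv
  rw [hT0]
  exact h

end Literature.NumberTheory.Automorphic.UnitaryGroup

end
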